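import Literature.Analysis.Complex.MontelSCV
import Literature.Analysis.Complex.OsgoodProofs
import HarnessLib

/-!
# Vitali's convergence theorem in several complex variables, and joint continuity of holomorphic families

Analysis/Complex support file (everything proved; no definitions, no named facts), the
several-variable companion of the tree's one-variable `VitaliConvergence`, built on the
several-variable Montel theorem `Literature.Analysis.Complex.SCV.exists_strictMono_tendstoLocallyUniformlyOn`
(`MontelSCV`) and Osgood's lemma (`OsgoodProofs`):

* `SCV.exists_tendstoLocallyUniformlyOn_of_unique_limits` — a locally bounded sequence of
  holomorphic maps on an open set converges locally uniformly as soon as all its locally uniform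
  subsequential limits agree (Montel + the subsequence principle);
* `SCV.eqOn_of_subseq_limits_of_tendsto_on_open` — on a connected open set, subsequential limits
  agree if the sequence converges pointwise on a nonempty open subset (identity theorem);
* `SCV.exists_tendstoLocallyUniformlyOn_of_tendsto_on_open`,
  `SCV.tendstoLocallyUniformlyOn_of_tendsto_on_open` — **Vitali**: a locally bounded sequence of
  holomorphic maps on a connected open `U` converging pointwise on a nonempty open `W ⊆ U`
  converges locally uniformly on `U` (to the given limit if that is holomorphic on `U`);
* `SCV.continuousOn_of_holomorphic_family` — **joint continuity of holomorphic families**: if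
  `f p` is holomorphic on a connected open `U` for every parameter `p` of a first-countable space,
  the family is locally bounded jointly in `(p, z)`, and `p ↦ f p z` is continuous for `z` in a
  nonempty open `W ⊆ U`, then `(p, z) ↦ f p z` is continuous on `P × U`.

The last statement is the mechanism behind "the spatial variables will always play the role of
parameters … Continuity with respect to them will be evident at each step" in Osterwalder–Schrader,
*Axioms for Euclidean Green's functions II*, Comm. Math. Phys. 42 (1975), Ch. V.2 p. 294: joint
continuity of the continued Schwinger functions in the complex times and the real spatial variables
follows from their joint continuity near the real (Euclidean) points and bounds uniform in the
spatial variables.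

## References

* E. C. Titchmarsh, *The Theory of Functions* (1939), §5.21 (Vitali), §5.23 (Montel); L. Hörmander,
  *An Introduction to Complex Analysis in Several Variables* (1973), Thm. 2.2.7. [HormanderSCV1973]
* K. Osterwalder, R. Schrader, Comm. Math. Phys. 42 (1975), Ch. V.2 p. 294. [OsterwalderSchraderCMP1975]

Everything here is folklore.
-/

noncomputable section

open Filter Metric Set Topology Function

namespace Literature.Analysis.Complex.SCV

variable {E : Type*} [NormedAddCommGroup E] [NormedSpace ℂ E] [FiniteDimensional ℂ E]
  {F : Type*} [NormedAddCommGroup F] [NormedSpace ℂ F] [CompleteSpace F] [ProperSpace F]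
  {U : Set E}

/-! ### The subsequence principle -/

omit [NormedSpace ℂ E] [FiniteDimensional ℂ E] [NormedSpace ℂ F] [CompleteSpace F] [ProperSpace F] in
/-- Local boundedness passes to subsequences. [folklore] -/
theorem locallyBounded_comp {f : ℕ → E → F}
    (hb : ∀ a ∈ U, ∃ M : ℝ, ∃ r > 0, ∀ n, ∀ z ∈ ball a r ∩ U, ‖f n z‖ ≤ M) (ψ : ℕ → ℕ) :
    ∀ a ∈ U, ∃ M : ℝ, ∃ r > 0, ∀ n, ∀ z ∈ ball a r ∩ U, ‖f (ψ n) z‖ ≤ M := fun a ha => by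
  obtain ⟨M, r, hr, hM⟩ := hb a ha
  exact ⟨M, r, hr, fun n z hz => hM (ψ n) z hz⟩

/-- **Locally uniform convergence from the uniqueness of subsequential limits** (several
variables): a locally bounded sequence of holomorphic maps on an open `U` all of whose locally
uniform subsequential limits agree on `U` converges locally uniformly on `U`, to a holomorphic map. [cite: HormanderSCV1973, Thm 2.2.7] -/
theorem exists_tendstoLocallyUniformlyOn_of_unique_limits (hU : IsOpen U) {f : ℕ → E → F}
    (hf : ∀ n, DifferentiableOn ℂ (f n) U)
    (hb : ∀ a ∈ U, ∃ M : ℝ, ∃ r > 0, ∀ n, ∀ z ∈ ball a r ∩ U, ‖f n z‖ ≤ M)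
    (huniq : ∀ (g g' : E → F) (ψ ψ' : ℕ → ℕ), StrictMono ψ → StrictMono ψ' →
      TendstoLocallyUniformlyOn (fun n => f (ψ n)) g atTop U →
      TendstoLocallyUniformlyOn (fun n => f (ψ' n)) g' atTop U → EqOn g g' U) :
    ∃ g : E → F, DifferentiableOn ℂ g U ∧ TendstoLocallyUniformlyOn f g atTop U := by
  haveI : ProperSpace E := FiniteDimensional.proper_rclike ℂ E
  obtain ⟨g, φ, hφ, hlim⟩ := exists_strictMono_tendstoLocallyUniformlyOn hU hf hb
  refine ⟨g, differentiableOn_of_tendstoLocallyUniformlyOn hU (fun n => hf (φ n)) hlim, ?_⟩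
  rw [tendstoLocallyUniformlyOn_iff_forall_isCompact hU]
  intro K hKU hK
  by_contra hnot
  rw [Metric.tendstoUniformlyOn_iff] at hnot
  push Not at hnot
  obtain ⟨ε, hε, hfreq⟩ := hnot
  obtain ⟨ψ, hψ, hbad⟩ := extraction_of_frequently_atTop hfreq
  -- a convergent subsequence of the bad subsequence
  obtain ⟨g', χ, hχ, hlim'⟩ := exists_strictMono_tendstoLocallyUniformlyOn hU
    (fun n => hf (ψ n)) (locallyBounded_comp hb ψ)
  have heq : EqOn g g' U := huniq g g' φ (ψ ∘ χ) hφ (hψ.comp hχ) hlim hlim'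
  have hK' := (tendstoLocallyUniformlyOn_iff_forall_isCompact hU).1 hlim' K hKU hK
  rw [Metric.tendstoUniformlyOn_iff] at hK'
  obtain ⟨N, hN⟩ := eventually_atTop.1 (hK' ε hε)
  obtain ⟨x, hxK, hx⟩ := hbad (χ N)
  have h1 : dist (g' x) (f (ψ (χ N)) x) < ε := hN N le_rfl x hxK
  rw [← heq (hKU hxK)] at h1
  exact absurd h1 (not_lt.2 hx)

/-! ### Uniqueness of the limits from pointwise convergence on an open subset -/

omit [NormedSpace ℂ E] [FiniteDimensional ℂ E] [NormedSpace ℂ F] [CompleteSpace F] [ProperSpace F] in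
/-- Two subsequential locally uniform limits agree wherever the full sequence converges. [folklore] -/
theorem subseq_limits_eq_of_tendsto {f : ℕ → E → F} {g g' : E → F} {ψ ψ' : ℕ → ℕ}
    (hψ : StrictMono ψ) (hψ' : StrictMono ψ')
    (hlim : TendstoLocallyUniformlyOn (fun n => f (ψ n)) g atTop U)
    (hlim' : TendstoLocallyUniformlyOn (fun n => f (ψ' n)) g' atTop U) {z : E} (hz : z ∈ U)
    {c : F} (hc : Tendsto (fun n => f n z) atTop (𝓝 c)) : g z = g' z := by
  have h1 : Tendsto (fun n => f (ψ n) z) atTop (𝓝 (g z)) := hlim.tendsto_at hz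
  have h2 : Tendsto (fun n => f (ψ' n) z) atTop (𝓝 (g' z)) := hlim'.tendsto_at hz
  have h1' : Tendsto (fun n => f (ψ n) z) atTop (𝓝 c) := hc.comp hψ.tendsto_atTop
  have h2' : Tendsto (fun n => f (ψ' n) z) atTop (𝓝 c) := hc.comp hψ'.tendsto_atTop
  rw [tendsto_nhds_unique h1 h1', tendsto_nhds_unique h2 h2']

omit [ProperSpace F] in
/-- **Uniqueness of subsequential limits from pointwise convergence on a nonempty open subset**
(the identity theorem in several variables, via Osgood's lemma): on a connected open `U`, if the
sequence converges pointwise on a nonempty open `W ⊆ U`, any two locally uniform limits of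
subsequences agree on `U`. [cite: HormanderSCV1973, Thm 2.2.1 and Thm 2.2.6] -/
theorem eqOn_of_subseq_limits_of_tendsto_on_open (hU : IsOpen U) (hUc : IsPreconnected U)
    {f : ℕ → E → F} (hf : ∀ n, DifferentiableOn ℂ (f n) U) {W : Set E} (hW : IsOpen W) (hWU : W ⊆ U)
    (hWne : W.Nonempty) (hpt : ∀ z ∈ W, ∃ c : F, Tendsto (fun n => f n z) atTop (𝓝 c))
    {g g' : E → F} {ψ ψ' : ℕ → ℕ} (hψ : StrictMono ψ) (hψ' : StrictMono ψ')
    (hlim : TendstoLocallyUniformlyOn (fun n => f (ψ n)) g atTop U)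
    (hlim' : TendstoLocallyUniformlyOn (fun n => f (ψ' n)) g' atTop U) : EqOn g g' U := by
  obtain ⟨z₀, hz₀⟩ := hWne
  have hga : AnalyticOnNhd ℂ g U :=
    analyticOnNhd_of_differentiableOn (differentiableOn_of_tendstoLocallyUniformlyOn hU (fun n => hf (ψ n)) hlim) hU
  have hga' : AnalyticOnNhd ℂ g' U :=
    analyticOnNhd_of_differentiableOn (differentiableOn_of_tendstoLocallyUniformlyOn hU (fun n => hf (ψ' n)) hlim') hU
  have hev : g =ᶠ[𝓝 z₀] g' := by
    filter_upwards [hW.mem_nhds hz₀] with z hz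
    obtain ⟨c, hc⟩ := hpt z hz
    exact subseq_limits_eq_of_tendsto hψ hψ' hlim hlim' (hWU hz) hc
  exact hga.eqOn_of_preconnected_of_eventuallyEq hga' hUc (hWU hz₀) hev

/-- **Vitali's convergence theorem in several variables.** A locally bounded sequence of
holomorphic maps on a connected open `U` which converges pointwise on a nonempty open `W ⊆ U`
converges locally uniformly on `U` to a holomorphic map. [cite: HormanderSCV1973, Thm 2.2.7] -/
theorem exists_tendstoLocallyUniformlyOn_of_tendsto_on_open (hU : IsOpen U) (hUc : IsPreconnected U)
    {f : ℕ → E → F} (hf : ∀ n, DifferentiableOn ℂ (f n) U)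
    (hb : ∀ a ∈ U, ∃ M : ℝ, ∃ r > 0, ∀ n, ∀ z ∈ ball a r ∩ U, ‖f n z‖ ≤ M)
    {W : Set E} (hW : IsOpen W) (hWU : W ⊆ U) (hWne : W.Nonempty)
    (hpt : ∀ z ∈ W, ∃ c : F, Tendsto (fun n => f n z) atTop (𝓝 c)) :
    ∃ g : E → F, DifferentiableOn ℂ g U ∧ TendstoLocallyUniformlyOn f g atTop U :=
  exists_tendstoLocallyUniformlyOn_of_unique_limits hU hf hb fun _ _ _ _ hψ hψ' hlim hlim' =>
    eqOn_of_subseq_limits_of_tendsto_on_open hU hUc hf hW hWU hWne hpt hψ hψ' hlim hlim'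

/-- **Vitali, with a prescribed limit**: if moreover `g` is continuous on `U` and `f n z → g z` for
`z ∈ W`, then `f → g` locally uniformly on `U`, provided `g` is holomorphic on `U`. [cite: HormanderSCV1973, Thm 2.2.7] -/
theorem tendstoLocallyUniformlyOn_of_tendsto_on_open (hU : IsOpen U) (hUc : IsPreconnected U)
    {f : ℕ → E → F} (hf : ∀ n, DifferentiableOn ℂ (f n) U)
    (hb : ∀ a ∈ U, ∃ M : ℝ, ∃ r > 0, ∀ n, ∀ z ∈ ball a r ∩ U, ‖f n z‖ ≤ M)
    {g : E → F} (hg : DifferentiableOn ℂ g U)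
    {W : Set E} (hW : IsOpen W) (hWU : W ⊆ U) (hWne : W.Nonempty)
    (hpt : ∀ z ∈ W, Tendsto (fun n => f n z) atTop (𝓝 (g z))) :
    TendstoLocallyUniformlyOn f g atTop U := by
  obtain ⟨g', hg', hlim⟩ := exists_tendstoLocallyUniformlyOn_of_tendsto_on_open hU hUc hf hb hW hWU hWne
    fun z hz => ⟨g z, hpt z hz⟩
  -- the limit is `g`: both are holomorphic on `U` and agree on `W`
  obtain ⟨z₀, hz₀⟩ := hWne
  have hga : AnalyticOnNhd ℂ g U := analyticOnNhd_of_differentiableOn hg hU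
  have hga' : AnalyticOnNhd ℂ g' U := analyticOnNhd_of_differentiableOn hg' hU
  have hev : g' =ᶠ[𝓝 z₀] g := by
    filter_upwards [hW.mem_nhds hz₀] with z hz
    exact tendsto_nhds_unique (hlim.tendsto_at (hWU hz)) (hpt z hz)
  have heq : EqOn g' g U := hga'.eqOn_of_preconnected_of_eventuallyEq hga hUc (hWU hz₀) hev
  exact hlim.congr_right heq

/-! ### Joint continuity of holomorphic families -/

/-- **Joint continuity of holomorphic families from continuity in the parameter on an open
subset.** Let `P` be a first-countable topological space, `U ⊆ E` a connected open set and
`f : P → E → F` with `f p` holomorphic on `U` for every `p`. Assume the family is locally bounded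
jointly — every `(p₀, a)`, `a ∈ U`, has a neighbourhood `V` of `p₀`, a radius `r > 0` and a bound
`M` with `‖f p z‖ ≤ M` for `p ∈ V`, `z ∈ B(a, r) ∩ U` — and that `p ↦ f p z` is continuous for every
`z` in a nonempty open `W ⊆ U`. Then `(p, z) ↦ f p z` is continuous on `P × U` (Vitali: along
`pⱼ → p` the maps `f pⱼ` converge locally uniformly on `U` to `f p`). This is how the continued
Schwinger functions of Osterwalder–Schrader II are jointly continuous in the complex times and the
real spatial parameters. [cite: OsterwalderSchraderCMP1975, Ch. V.2 p. 294] -/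
theorem continuousOn_of_holomorphic_family {P : Type*} [TopologicalSpace P] [FirstCountableTopology P]
    (hU : IsOpen U) (hUc : IsPreconnected U) {f : P → E → F} (hf : ∀ p, DifferentiableOn ℂ (f p) U)
    (hb : ∀ (p₀ : P), ∀ a ∈ U, ∃ V ∈ 𝓝 p₀, ∃ M : ℝ, ∃ r > 0, ∀ p ∈ V, ∀ z ∈ ball a r ∩ U, ‖f p z‖ ≤ M)
    {W : Set E} (hW : IsOpen W) (hWU : W ⊆ U) (hWne : W.Nonempty)
    (hcont : ∀ z ∈ W, Continuous fun p => f p z) :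
    ContinuousOn (fun q : P × E => f q.1 q.2) (univ ×ˢ U) := by
  haveI : ProperSpace E := FiniteDimensional.proper_rclike ℂ E
  rintro ⟨p, z⟩ ⟨-, hz⟩
  -- sequential characterisation of continuity within `univ ×ˢ U` at `(p, z)`
  rw [ContinuousWithinAt, tendsto_iff_seq_tendsto]
  intro q hq
  have hq1 : Tendsto (fun j => (q j).1) atTop (𝓝 p) :=
    (continuous_fst.tendsto _).comp (tendsto_nhds_of_tendsto_nhdsWithin hq)
  have hq2 : Tendsto (fun j => (q j).2) atTop (𝓝[U] z) := by
    refine tendsto_nhdsWithin_iff.2 ⟨(continuous_snd.tendsto _).comp (tendsto_nhds_of_tendsto_nhdsWithin hq), ?_⟩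
    have h := eventually_mem_of_tendsto_nhdsWithin hq
    exact h.mono fun j hj => hj.2
  -- the maps `f (q j).1` converge to `f p` locally uniformly on `U` (Vitali), along every tail in
  -- a neighbourhood of `p` where the family is locally bounded; we prove directly the uniqueness
  -- of subsequential limits of the sequence `j ↦ f (q j).1`, after checking local boundedness.
  have hlb : ∀ a ∈ U, ∃ M : ℝ, ∃ r > 0, ∀ j, ∀ w ∈ ball a r ∩ U, ‖f (q j).1 w‖ ≤ M := by
    intro a ha
    obtain ⟨V, hV, M, r, hr, hM⟩ := hb p a ha
    -- eventually `(q j).1 ∈ V`; the finitely many earlier maps are bounded near `a` by continuity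
    obtain ⟨J, hJ⟩ := eventually_atTop.1 (hq1.eventually (mem_of_mem_nhds hV |> fun _ => hV))
    -- bound for the first `J` maps on a small closed ball around `a`
    obtain ⟨ρ, hρ, hρU⟩ := Metric.isOpen_iff.1 hU a ha
    have hfin : ∀ j, ∃ Mj : ℝ, ∀ w ∈ closedBall a (ρ / 2), ‖f (q j).1 w‖ ≤ Mj := by
      intro j
      have hcpt : IsCompact (closedBall a (ρ / 2)) := isCompact_closedBall _ _
      have hsub : closedBall a (ρ / 2) ⊆ U := (closedBall_subset_ball (by linarith)).trans hρU
      obtain ⟨Mj, hMj⟩ := hcpt.exists_bound_of_continuousOn ((hf (q j).1).continuousOn.mono hsub)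
      exact ⟨Mj, hMj⟩
    choose Mj hMj using hfin
    refine ⟨max M (∑ j ∈ Finset.range J, |Mj j|), min r (ρ / 2), lt_min hr (by linarith), fun j w hw => ?_⟩
    have hwr : w ∈ ball a r ∩ U := ⟨ball_subset_ball (min_le_left _ _) hw.1, hw.2⟩
    have hwρ : w ∈ closedBall a (ρ / 2) := ball_subset_closedBall (ball_subset_ball (min_le_right _ _) hw.1)
    by_cases hj : J ≤ j
    · exact (hM _ (hJ j hj) w hwr).trans (le_max_left _ _)
    · push Not at hj
      have h1 : ‖f (q j).1 w‖ ≤ Mj j := hMj j w hwρ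
      have h2 : Mj j ≤ ∑ j ∈ Finset.range J, |Mj j| :=
        (le_abs_self _).trans (Finset.single_le_sum (f := fun j => |Mj j|) (fun _ _ => abs_nonneg _)
          (Finset.mem_range.2 hj))
      exact h1.trans (h2.trans (le_max_right _ _))
  -- pointwise convergence on `W`
  have hptW : ∀ w ∈ W, Tendsto (fun j => f (q j).1 w) atTop (𝓝 (f p w)) := fun w hw =>
    ((hcont w hw).tendsto p).comp hq1
  have hlim : TendstoLocallyUniformlyOn (fun j => f (q j).1) (f p) atTop U :=
    tendstoLocallyUniformlyOn_of_tendsto_on_open hU hUc (fun j => hf _) hlb (hf p) hW hWU hWne hptW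
  -- conclusion
  exact hlim.tendsto_comp ((hf p).continuousOn.continuousWithinAt hz) hz hq2

end Literature.Analysis.Complex.SCV
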